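import Summits.CriticalPhenomena.PercolationContinuityZ3.Theorems.PercNearOneGluingNoHeavyLowerTailAntitheticCycleOplusBoxes
import Summits.CriticalPhenomena.PercolationContinuityZ3.Theorems.PercNearOneGluingNoHeavyLowerTailAntitheticBoxes
import HarnessLib

/-!
# `NoHeavyLowerTail` (stmt-CriticalPhenomena-4575) — antithetic cluster pairs: PR4 ON A CYCLE — the mixed event `{P ∈ X, Q ∉ Y}` of a cycle
# through the source is a disjoint union of red-dominated boxes (HOME/THEOREM-Theta.md §1 (PR4) and §3, prim-hp-2 gen 62)

Support file (`--supports stmt-CriticalPhenomena-4575`, hull-port prover `prim-hp-2`, gen 62).  No definitions, no named facts, no sorries;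
standard axioms.  Setting of …AntitheticCycleRuns / …AntitheticCycleOplusBoxes: cycle `v 0 = s, …, v (n-1)` (`n ≥ 3`), `E = Cyc.edgeSet n v`,
`X ω = openCluster (ω ∩ E) s`, `Y ω = openCluster (ωᶜ ∩ E) s`; two cycle vertices `P = v p`, `Q = v q` (`0 < p, q < n`, `p = q` allowed).

**`Antithetic.Cyc.termTwo_cycle_nonneg`** (PR4 of HOME/THEOREM-Theta.md for the bare cycle): for all super-odd twisted-monotone `K₁, K₂`,
`0 ≤ Σ_{ω : P ∈ X ω, Q ∉ Y ω} K₁(X ω, Y ω)·K₂(X ω, Y ω)`.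
With `K(A, B) = h(A ∪ U, B)` (`h` odd twisted-monotone, `U` a fixed vertex set) this is `TII^{(P)}_C(P, Q; h) ≥ 0`, the last term of the pendant
peeling in THEOREM Θ.  PROOF (the memo's block freezing made explicit): `Q ∉ Y` iff there are red pairs `edge i₀`, `i₀ < q`, and `edge j₀`,
`q ≤ j₀ < n`; taking `i₀` maximal and `j₀` minimal, the pairs strictly between are blue (the frozen blue arc `Z ∋ Q`).  If `Z = {Q}`
(`i₀ = q-1`, `j₀ = q`) the cell is refined by the ⊕-boxes of …AntitheticCycleOplusBoxes (two extra forced-red pairs); otherwise `P ∈ X` forces the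
arc from `s` to `P` avoiding `Z` to be red and the cell is a single box.  Every box is red-dominated (`Cyc.dom_box`, `Cyc.dom_top`,
`Cyc.dom_cw`, `Cyc.dom_ccw`), and `Antithetic.Box.boxes_sum_nonneg` sums up.
[cite: VandenbergHaggstromKahn2005, §1 p. 6 ("Harris' inequality"), §1 p. 3 (open cluster `C_s`)]
-/

noncomputable section

namespace Summit.CriticalPhenomena.PercolationContinuityZ3.Theorems

open Literature.Probability.Percolation
open scoped Classical

namespace Antithetic

namespace Cyc

variable {V : Type*} {n : ℕ} {v : ℕ → V} (hn : 3 ≤ n) (hinj : ∀ i j, i < n → j < n → v i = v j → i = j) (hper : v n = v 0)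
include hn hinj hper

/-- `v a ∉ Y ω` (`0 < a < n`) iff there is a red pair on each of the two arcs from `s` to `v a`. [this work] -/
theorem not_mem_Y_iff (ω : Set (Sym2 V)) {a : ℕ} (ha0 : 0 < a) (han : a < n) :
    v a ∉ openCluster (ωᶜ ∩ edgeSet n v) (v 0) ↔
      (∃ i, i < a ∧ edge v i ∈ ω) ∧ (∃ i, a ≤ i ∧ i < n ∧ edge v i ∈ ω) := by
  rw [mem_X_iff hn hinj hper ωᶜ ha0 han, not_or]
  simp only [Set.mem_compl_iff, not_forall, not_not, exists_prop]

/-- **Red domination, clockwise path forced** (cells of PR4 with a nontrivial blue arc beyond `P`): if the pairs `edge 0` and `edge j₀`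
(`j₀ < n`) are forced red and `ω, ω'` are opposite on the non-forced pairs beyond `j₀`, then `Y ω' ⊆ X ω`. [this work] -/
theorem dom_cw (ω ω' : Set (Sym2 V)) {j₀ : ℕ} (hj₀ : j₀ < n) (red : ℕ → Prop) (h0 : red 0) (hj : red j₀)
    (hω' : ∀ i, i < n → red i → edge v i ∈ ω')
    (hflip : ∀ i, j₀ < i → i < n → ¬ red i → (edge v i ∈ ω' ↔ edge v i ∉ ω)) :
    openCluster (ω'ᶜ ∩ edgeSet n v) (v 0) ⊆ openCluster (ω ∩ edgeSet n v) (v 0) := by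
  intro u hu
  obtain ⟨b, hbn, rfl⟩ := idx_of_mem_X hn hinj hper ω'ᶜ hu
  by_cases hb0 : b = 0
  · rw [hb0]; exact mem_openCluster_self _ _
  have hb0' : 0 < b := Nat.pos_of_ne_zero hb0
  rcases (mem_X_iff hn hinj hper ω'ᶜ hb0' hbn).1 hu with hcw | hccw
  · exact absurd (hω' 0 (by omega) h0) (hcw 0 hb0')
  · by_cases hbj : b ≤ j₀
    · exact absurd (hω' j₀ hj₀ hj) (hccw j₀ hbj hj₀)
    · refine (mem_X_iff hn hinj hper ω hb0' hbn).2 (Or.inr fun i hbi hin => ?_)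
      have hiω' : edge v i ∉ ω' := hccw i hbi hin
      have hri : ¬ red i := fun h => hiω' (hω' i hin h)
      by_contra h
      exact hiω' ((hflip i (by omega) hin hri).2 h)

/-- **Red domination, counter-clockwise path forced**: if `edge (n-1)` and `edge i₀` (`i₀ < n`) are forced red and `ω, ω'` are opposite on the
non-forced pairs before `i₀`, then `Y ω' ⊆ X ω`. [this work] -/
theorem dom_ccw (ω ω' : Set (Sym2 V)) {i₀ : ℕ} (hi₀ : i₀ < n) (red : ℕ → Prop) (hlast : red (n - 1)) (hi : red i₀)
    (hω' : ∀ i, i < n → red i → edge v i ∈ ω')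
    (hflip : ∀ i, i < i₀ → ¬ red i → (edge v i ∈ ω' ↔ edge v i ∉ ω)) :
    openCluster (ω'ᶜ ∩ edgeSet n v) (v 0) ⊆ openCluster (ω ∩ edgeSet n v) (v 0) := by
  intro u hu
  obtain ⟨b, hbn, rfl⟩ := idx_of_mem_X hn hinj hper ω'ᶜ hu
  by_cases hb0 : b = 0
  · rw [hb0]; exact mem_openCluster_self _ _
  have hb0' : 0 < b := Nat.pos_of_ne_zero hb0
  rcases (mem_X_iff hn hinj hper ω'ᶜ hb0' hbn).1 hu with hcw | hccw
  · by_cases hbi : i₀ < b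
    · exact absurd (hω' i₀ hi₀ hi) (hcw i₀ hbi)
    · refine (mem_X_iff hn hinj hper ω hb0' hbn).2 (Or.inl fun i hib => ?_)
      have hiω' : edge v i ∉ ω' := hcw i hib
      have hri : ¬ red i := fun h => hiω' (hω' i (by omega) h)
      by_contra h
      exact hiω' ((hflip i (by omega) hri).2 h)
  · exact absurd (hω' (n - 1) (by omega) hlast) (hccw (n - 1) (by omega) (by omega))

/-- **PR4 ON A CYCLE** (HOME/THEOREM-Theta.md §1 (PR4), §3).  For cycle vertices `P = v p`, `Q = v q` (`0 < p, q < n`) and all super-odd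
twisted-monotone `K₁, K₂`: `0 ≤ Σ_{ω : P ∈ X ω, Q ∉ Y ω} K₁(X ω, Y ω)·K₂(X ω, Y ω)`.  (With `K(A,B) = h(A ∪ U, B)`: `TII^{(P)}_C(P,Q; h) ≥ 0`.)
The event is a disjoint union of red-dominated boxes (frozen blue arc around `Q`, refined by the ⊕-boxes when the arc is `{Q}`). [this work] -/
theorem termTwo_cycle_nonneg [Fintype V] {p q : ℕ} (hp0 : 0 < p) (hpn : p < n) (hq0 : 0 < q) (hqn : q < n)
    (K₁ K₂ : Set V → Set V → ℝ)
    (hK₁ : ∀ ⦃P P' Q Q' : Set V⦄, P ⊆ P' → Q' ⊆ Q → K₁ P Q ≤ K₁ P' Q') (hso₁ : ∀ P Q, 0 ≤ K₁ P Q + K₁ Q P)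
    (hK₂ : ∀ ⦃P P' Q Q' : Set V⦄, P ⊆ P' → Q' ⊆ Q → K₂ P Q ≤ K₂ P' Q') (hso₂ : ∀ P Q, 0 ≤ K₂ P Q + K₂ Q P) :
    0 ≤ ∑ ω ∈ Finset.univ.filter (fun ω : Set (Sym2 V) =>
        v p ∈ openCluster (ω ∩ edgeSet n v) (v 0) ∧ v q ∉ openCluster (ωᶜ ∩ edgeSet n v) (v 0)),
      K₁ (openCluster (ω ∩ edgeSet n v) (v 0)) (openCluster (ωᶜ ∩ edgeSet n v) (v 0)) *
        K₂ (openCluster (ω ∩ edgeSet n v) (v 0)) (openCluster (ωᶜ ∩ edgeSet n v) (v 0)) := by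
  -- index bookkeeping: a cell is `t = (i₀, j₀, c)`: `edge i₀`, `edge j₀` red (`i₀ < q ≤ j₀ < n`), the pairs strictly between blue; `c` selects
  -- the sub-box: `c = n` TOP / `c < n` ⊕-BOX `c` (only when the blue arc is trivial), `c = n+1` clockwise path to `P` red, `c = n+2`
  -- counter-clockwise path to `P` red.
  let arc : ℕ → ℕ → Prop := fun k i => (k < p ∧ k < i) ∨ (p ≤ k ∧ i < k)
  let redI : ℕ → ℕ → ℕ → ℕ → Prop := fun i₀ j₀ cc i =>
    i = i₀ ∨ i = j₀ ∨ cc = n ∨ (cc < n ∧ arc cc i) ∨ (cc = n + 1 ∧ i < p) ∨ (cc = n + 2 ∧ p ≤ i)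
  let blueI : ℕ → ℕ → ℕ → ℕ → Prop := fun i₀ j₀ cc i => (i₀ < i ∧ i < j₀) ∨ (cc < n ∧ i = cc)
  let valid : ℕ → ℕ → ℕ → Prop := fun i₀ j₀ cc => i₀ < q ∧ q ≤ j₀ ∧ j₀ < n ∧
    ((i₀ + 1 = q ∧ j₀ = q ∧ (cc = n ∨ (cc < n ∧ cc ≠ q - 1 ∧ cc ≠ q))) ∨
      (i₀ + 2 ≤ j₀ ∧ p ≤ i₀ + 1 ∧ cc = n + 1) ∨ (i₀ + 2 ≤ j₀ ∧ j₀ ≤ p ∧ cc = n + 2))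
  let C := {t : ℕ × ℕ × ℕ // valid t.1 t.2.1 t.2.2}
  let Fix : C → Set (Sym2 V) := fun c =>
    {e | ∃ i, i < n ∧ (redI c.1.1 c.1.2.1 c.1.2.2 i ∨ blueI c.1.1 c.1.2.1 c.1.2.2 i) ∧ e = edge v i}
  let N : C → Set (Sym2 V) := fun c => {e | ∃ i, i < n ∧ redI c.1.1 c.1.2.1 c.1.2.2 i ∧ e = edge v i}
  have hedge_inj : ∀ {i i' : ℕ}, i < n → i' < n → edge v i = edge v i' → i = i' := fun hi hi' h => edge_inj hn hinj hper hi hi' h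
  -- forced-red and forced-blue indices are disjoint
  have hdisj : ∀ i₀ j₀ cc, valid i₀ j₀ cc → ∀ i, i < n → redI i₀ j₀ cc i → blueI i₀ j₀ cc i → False := by
    intro i₀ j₀ cc hv i hi hr hb
    simp only [redI, blueI, valid, arc] at hr hb hv
    omega
  -- membership in a cell, spelled out
  have hmem_iff : ∀ i₀ j₀ cc (hv : valid i₀ j₀ cc) (ω : Set (Sym2 V)),
      (∀ e ∈ Fix ⟨(i₀, j₀, cc), hv⟩, (e ∈ ω ↔ e ∈ N ⟨(i₀, j₀, cc), hv⟩)) ↔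
        ((∀ i, i < n → blueI i₀ j₀ cc i → edge v i ∉ ω) ∧ ∀ i, i < n → redI i₀ j₀ cc i → edge v i ∈ ω) := by
    intro i₀ j₀ cc hv ω
    have hmemN : ∀ i, i < n → (edge v i ∈ N ⟨(i₀, j₀, cc), hv⟩ ↔ redI i₀ j₀ cc i) := by
      intro i hi
      constructor
      · rintro ⟨i', hi', hred, he⟩
        rw [hedge_inj hi hi' he]; exact hred
      · exact fun h => ⟨i, hi, h, rfl⟩
    constructor
    · intro h
      refine ⟨fun i hi hb hiω => ?_, fun i hi hred => ?_⟩
      · have h1 := (h (edge v i) ⟨i, hi, Or.inr hb, rfl⟩).1 hiω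
        rw [hmemN i hi] at h1
        exact hdisj i₀ j₀ cc hv i hi h1 hb
      · exact (h (edge v i) ⟨i, hi, Or.inl hred, rfl⟩).2 ((hmemN i hi).2 hred)
    · rintro ⟨hblues, hreds⟩ e ⟨i, hi, hor, rfl⟩
      rw [hmemN i hi]
      rcases hor with hred | hb
      · exact iff_of_true (hreds i hi hred) hred
      · exact iff_of_false (hblues i hi hb) (fun hred => hdisj i₀ j₀ cc hv i hi hred hb)
  refine Box.boxes_sum_nonneg (edgeSet n v) (v 0) _ Fix N ?_ ?_ ?_ ?_ hK₁ hso₁ hK₂ hso₂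
  · -- COVER
    intro ω hω
    obtain ⟨hP, hQ⟩ := (Finset.mem_filter.1 hω).2
    obtain ⟨⟨i₁, hi₁q, hi₁⟩, ⟨j₁, hqj₁, hj₁n, hj₁⟩⟩ := (not_mem_Y_iff hn hinj hper ω hq0 hqn).1 hQ
    -- the largest red index below `q`
    have hexI : ∃ m, m < q ∧ edge v (q - 1 - m) ∈ ω :=
      ⟨q - 1 - i₁, by omega, by rwa [show q - 1 - (q - 1 - i₁) = i₁ by omega]⟩
    have hspI := Nat.find_spec hexI
    have hi₀max : ∀ m, q - 1 - Nat.find hexI < m → m < q → edge v m ∉ ω := by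
      intro m h1 h2 hm
      have hmin := Nat.find_min hexI (m := q - 1 - m) (by omega)
      exact hmin ⟨by omega, by rwa [show q - 1 - (q - 1 - m) = m by omega]⟩
    obtain ⟨i₀, hi₀def⟩ : ∃ i₀, i₀ = q - 1 - Nat.find hexI := ⟨_, rfl⟩
    have hi₀red : edge v i₀ ∈ ω := by rw [hi₀def]; exact hspI.2
    rw [← hi₀def] at hi₀max
    have hi₀q : i₀ < q := by omega
    -- the smallest red index `≥ q`
    have hexJ : ∃ j, q ≤ j ∧ j < n ∧ edge v j ∈ ω := ⟨j₁, hqj₁, hj₁n, hj₁⟩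
    have hspJ := Nat.find_spec hexJ
    have hj₀min : ∀ m, q ≤ m → m < Nat.find hexJ → edge v m ∉ ω := by
      intro m h1 h2 hm
      exact Nat.find_min hexJ h2 ⟨h1, by omega, hm⟩
    obtain ⟨j₀, hj₀def⟩ : ∃ j₀, j₀ = Nat.find hexJ := ⟨_, rfl⟩
    rw [← hj₀def] at hspJ hj₀min
    obtain ⟨hqj₀, hj₀n, hj₀red⟩ := hspJ
    have hblue : ∀ m, i₀ < m → m < j₀ → edge v m ∉ ω := by
      intro m h1 h2
      by_cases hmq : m < q
      · exact hi₀max m h1 hmq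
      · exact hj₀min m (by omega) h2
    -- a member of the cell `(i₀, j₀, cc)` as soon as the sub-box conditions hold
    have hmk : ∀ (cc : ℕ) (hv : valid i₀ j₀ cc), (cc < n → edge v cc ∉ ω) →
        (∀ i, i < n → (cc = n ∨ (cc < n ∧ arc cc i) ∨ (cc = n + 1 ∧ i < p) ∨ (cc = n + 2 ∧ p ≤ i)) → edge v i ∈ ω) →
        ∃ c : C, ∀ e ∈ Fix c, (e ∈ ω ↔ e ∈ N c) := by
      intro cc hv hcb hcr
      refine ⟨⟨(i₀, j₀, cc), hv⟩, (hmem_iff i₀ j₀ cc hv ω).2 ⟨fun i hi hb => ?_, fun i hi hred => ?_⟩⟩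
      · rcases hb with ⟨h1, h2⟩ | ⟨h1, h2⟩
        · exact hblue i h1 h2
        · rw [h2]; exact hcb h1
      · rcases hred with h | h | h
        · rw [h]; exact hi₀red
        · rw [h]; exact hj₀red
        · exact hcr i hi h
    by_cases htriv : i₀ + 1 = q ∧ j₀ = q
    · -- trivial blue arc: refine by the ⊕-boxes
      rcases oplus_cover hn hinj hper hp0 hpn ω hP with htop | ⟨k, hk, hbk, hbox⟩
      · exact hmk n ⟨hi₀q, hqj₀, hj₀n, Or.inl ⟨htriv.1, htriv.2, Or.inl rfl⟩⟩ (fun h => absurd h (lt_irrefl n))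
          fun i hi _ => htop i hi
      · have hk1 : k ≠ q - 1 := fun h => hbk (by rw [h, show q - 1 = i₀ by omega]; exact hi₀red)
        have hk2 : k ≠ q := fun h => hbk (by rw [h, ← htriv.2]; exact hj₀red)
        refine hmk k ⟨hi₀q, hqj₀, hj₀n, Or.inl ⟨htriv.1, htriv.2, Or.inr ⟨hk, hk1, hk2⟩⟩⟩ (fun _ => hbk) fun i hi h => ?_
        rcases h with h | ⟨-, h⟩ | ⟨h, -⟩ | ⟨h, -⟩
        · omega
        · exact hbox i hi h
        · omega
        · omega
    · have hgap : i₀ + 2 ≤ j₀ := by omega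
      rcases (mem_X_iff hn hinj hper ω hp0 hpn).1 hP with hcw | hccw
      · have hpi : p ≤ i₀ + 1 := by
          by_contra h
          exact hblue (i₀ + 1) (by omega) (by omega) (hcw (i₀ + 1) (by omega))
        refine hmk (n + 1) ⟨hi₀q, hqj₀, hj₀n, Or.inr (Or.inl ⟨hgap, hpi, rfl⟩)⟩ (fun h => absurd h (by omega)) fun i hi h => ?_
        rcases h with h | ⟨h, -⟩ | ⟨-, h⟩ | ⟨h, -⟩
        · omega
        · omega
        · exact hcw i h
        · omega
      · have hpj : j₀ ≤ p := by
          by_contra h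
          exact hblue (j₀ - 1) (by omega) (by omega) (hccw (j₀ - 1) (by omega) (by omega))
        refine hmk (n + 2) ⟨hi₀q, hqj₀, hj₀n, Or.inr (Or.inr ⟨hgap, hpj, rfl⟩)⟩ (fun h => absurd h (by omega)) fun i hi h => ?_
        rcases h with h | ⟨h, -⟩ | ⟨h, -⟩ | ⟨-, h⟩
        · omega
        · omega
        · omega
        · exact hccw i h hi
  · -- INSIDE
    rintro ⟨⟨i₀, j₀, cc⟩, hv⟩ ω hmem
    obtain ⟨hblues, hreds⟩ := (hmem_iff i₀ j₀ cc hv ω).1 hmem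
    have hv' : valid i₀ j₀ cc := hv
    obtain ⟨hi₀q, hqj₀, hj₀n, hcase⟩ := hv'
    refine Finset.mem_filter.2 ⟨Finset.mem_univ _, ?_, ?_⟩
    · -- `P ∈ X`
      rcases hcase with ⟨-, -, hc | ⟨hc, -, -⟩⟩ | ⟨-, hpi, hc⟩ | ⟨-, hpj, hc⟩
      · exact mem_X_of_top hn hinj hper hp0 hpn ω fun i hi => hreds i hi (Or.inr (Or.inr (Or.inl hc)))
      · exact mem_X_of_box hn hinj hper hp0 hpn ω hc fun i hi harc => hreds i hi (Or.inr (Or.inr (Or.inr (Or.inl ⟨hc, harc⟩))))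
      · exact (mem_X_iff hn hinj hper ω hp0 hpn).2
          (Or.inl fun i hi => hreds i (by omega) (Or.inr (Or.inr (Or.inr (Or.inr (Or.inl ⟨hc, hi⟩))))))
      · exact (mem_X_iff hn hinj hper ω hp0 hpn).2
          (Or.inr fun i hpi' hin => hreds i hin (Or.inr (Or.inr (Or.inr (Or.inr (Or.inr ⟨hc, hpi'⟩))))))
    · -- `Q ∉ Y`
      exact (not_mem_Y_iff hn hinj hper ω hq0 hqn).2
        ⟨⟨i₀, hi₀q, hreds i₀ (by omega) (Or.inl rfl)⟩, ⟨j₀, hqj₀, hj₀n, hreds j₀ hj₀n (Or.inr (Or.inl rfl))⟩⟩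
  · -- UNIQUENESS
    rintro ⟨⟨i₀, j₀, cc⟩, hv⟩ ⟨⟨i₀', j₀', cc'⟩, hv'⟩ ω hmem hmem'
    obtain ⟨hblues, hreds⟩ := (hmem_iff i₀ j₀ cc hv ω).1 hmem
    obtain ⟨hblues', hreds'⟩ := (hmem_iff i₀' j₀' cc' hv' ω).1 hmem'
    have hv1 : valid i₀ j₀ cc := hv
    have hv2 : valid i₀' j₀' cc' := hv'
    simp only [valid] at hv1 hv2
    have hred₀ : edge v i₀ ∈ ω := hreds i₀ (by omega) (Or.inl rfl)
    have hred₀' : edge v i₀' ∈ ω := hreds' i₀' (by omega) (Or.inl rfl)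
    have hred₁ : edge v j₀ ∈ ω := hreds j₀ (by omega) (Or.inr (Or.inl rfl))
    have hred₁' : edge v j₀' ∈ ω := hreds' j₀' (by omega) (Or.inr (Or.inl rfl))
    have hI : i₀ = i₀' := by
      by_contra hne
      rcases Nat.lt_or_gt_of_ne hne with h | h
      · exact hblues i₀' (by omega) (Or.inl ⟨h, by omega⟩) hred₀'
      · exact hblues' i₀ (by omega) (Or.inl ⟨h, by omega⟩) hred₀
    have hJ : j₀ = j₀' := by
      by_contra hne
      rcases Nat.lt_or_gt_of_ne hne with h | h
      · exact hblues' j₀ (by omega) (Or.inl ⟨by omega, h⟩) hred₁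
      · exact hblues j₀' (by omega) (Or.inl ⟨by omega, h⟩) hred₁'
    subst hI hJ
    have hcc : cc = cc' := by
      -- a ⊕-box index is determined (`box_uniq`), TOP and a ⊕-box exclude each other, the path boxes are determined by `p`
      by_cases h1 : cc < n
      · have hb1 : edge v cc ∉ ω := hblues cc h1 (Or.inr ⟨h1, rfl⟩)
        by_cases h2 : cc' < n
        · have hb2 : edge v cc' ∉ ω := hblues' cc' h2 (Or.inr ⟨h2, rfl⟩)
          exact box_uniq (p := p) ω h1 h2 hb1 (fun i hi harc => hreds i hi (Or.inr (Or.inr (Or.inr (Or.inl ⟨h1, harc⟩)))))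
            hb2 (fun i hi harc => hreds' i hi (Or.inr (Or.inr (Or.inr (Or.inl ⟨h2, harc⟩)))))
        · have h3 : cc' = n := by omega
          exact absurd (hreds' cc h1 (Or.inr (Or.inr (Or.inl h3)))) hb1
      · by_cases h2 : cc' < n
        · have hb2 : edge v cc' ∉ ω := hblues' cc' h2 (Or.inr ⟨h2, rfl⟩)
          have h3 : cc = n := by omega
          exact absurd (hreds cc' h2 (Or.inr (Or.inr (Or.inl h3)))) hb2
        · omega
    subst hcc
    rfl
  · -- RED DOMINATION
    rintro ⟨⟨i₀, j₀, cc⟩, hv⟩ ω ω' hmem hmem' hflip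
    obtain ⟨hblues, hreds⟩ := (hmem_iff i₀ j₀ cc hv ω).1 hmem
    obtain ⟨hblues', hreds'⟩ := (hmem_iff i₀ j₀ cc hv ω').1 hmem'
    have hv1 : valid i₀ j₀ cc := hv
    obtain ⟨hi₀q, hqj₀, hj₀n, hcase⟩ := hv1
    -- a pair that is neither forced red nor forced blue is free
    have hfl : ∀ i, i < n → ¬ redI i₀ j₀ cc i → ¬ blueI i₀ j₀ cc i → (edge v i ∈ ω' ↔ edge v i ∉ ω) := by
      intro i hi hr hb
      refine hflip (edge v i) fun hmemF => ?_
      obtain ⟨i', hi', hor, he⟩ := hmemF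
      have hii' := hedge_inj hi hi' he
      subst hii'
      exact hor.elim hr hb
    rcases hcase with ⟨hi₀1, hj₀1, hc | ⟨hc, hc1, hc2⟩⟩ | ⟨hgap, hpi, hc⟩ | ⟨hgap, hpj, hc⟩
    · exact dom_top hn hinj hper ω ω' fun i hi => hreds' i hi (Or.inr (Or.inr (Or.inl hc)))
    · refine dom_box hn hinj hper ω ω' (k := cc) (redI i₀ j₀ cc) ?_ hreds hreds' fun i hi hik hnred => ?_
      · by_cases hkp : cc < p
        · exact Or.inl ⟨by omega, fun i hki hin => Or.inr (Or.inr (Or.inr (Or.inl ⟨hc, Or.inl ⟨hkp, hki⟩⟩)))⟩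
        · exact Or.inr ⟨by omega, fun i hik => Or.inr (Or.inr (Or.inr (Or.inl ⟨hc, Or.inr ⟨by omega, hik⟩⟩)))⟩
      · refine hfl i hi hnred fun hb => ?_
        rcases hb with ⟨h1, h2⟩ | ⟨-, h2⟩
        · omega
        · exact hik h2
    · refine dom_cw hn hinj hper ω ω' hj₀n (redI i₀ j₀ cc) ?_ (Or.inr (Or.inl rfl)) hreds' fun i hji hin hnred => ?_
      · exact Or.inr (Or.inr (Or.inr (Or.inr (Or.inl ⟨hc, hp0⟩))))
      · refine hfl i hin hnred fun hb => ?_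
        rcases hb with ⟨h1, h2⟩ | ⟨h1, -⟩
        · omega
        · omega
    · refine dom_ccw hn hinj hper ω ω' (show i₀ < n by omega) (redI i₀ j₀ cc) ?_ (Or.inl rfl) hreds' fun i hii hnred => ?_
      · exact Or.inr (Or.inr (Or.inr (Or.inr (Or.inr ⟨hc, by omega⟩))))
      · refine hfl i (by omega) hnred fun hb => ?_
        rcases hb with ⟨h1, h2⟩ | ⟨h1, -⟩
        · omega
        · omega

end Cyc

end Antithetic

end Summit.CriticalPhenomena.PercolationContinuityZ3.Theorems
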